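import Mathlib
import Summits.ValiantsHypothesis.ValiantsHypothesis.Theorems.BarrierLeverPartitionMinorsHitByVPHiddenStatesPathTableTransfer

/-!
# Route BarrierLever — item `PartitionMinorsHitByVP` (stmt-ValiantsHypothesis-19717), line `hidden-states`:
# INERT COORDINATES for the dual-vector engine — forced-present (`Z`) and forced-absent (`W`) coordinates

Helper file (`--supports stmt-ValiantsHypothesis-19717`; cell valiant-natproofs, 𝒟-side door (c), registered line
`Cruxes/PartitionMinorsHitByVP/Lines/hidden_states.lean` v8; prover seat val-np-p6 gen 16).  Closes NO item; definition-free; companion of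
`…HiddenStatesPathTableTransfer` (memo HOME/val-np-p6/g16/MEMO-valnp6-g16.md §3, «first shell for every t»).

Given dual-vector data on `ι₁` (table `w₁`, functional `ζ₁` supported on `|R| ≤ k`, annihilating the rows `S ≠ X₁`, `|S| ≤ k`, not the
row `Y₁`), extend to `ι₁ ⊕ ι₂` by an IDENTITY table on `ι₂` (no cross sources) and the functional
`ζ'(R) = [R.toRight = Z] · ζ₁(R.toLeft)` for a fixed `Z ⊆ ι₂`: then (★ `sum_maps_inert`) the row functional factorises,
`Λ'(S) = [S.toRight = Z] · Λ₁(S.toLeft)`, so the extended data again satisfy the hypotheses of `det_ne_zero_of_dual` with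
`k' = k + |Z|`, `X' = X₁ ⊔ Z`, `Y' = Y₁ ⊔ Z` (`inert_hζ`, `inert_hA`, `inert_hB`, `inert_unipotent`, ★ `det_ne_zero_of_dual_inert`).
USE: the first-shell class `B_t(2t+1) − A + C` is `P_k` (`k = t − |A ∩ C|`) plus the inert coordinates `Z = A ∩ C` (present in both
`A` and `C`) and `W = (A ∪ C)ᶜ`.

WHAT THIS IS NOT: no item statement; nothing on crux 14610 or VP ≠ VNP.
-/

set_option linter.dupNamespace false

namespace Summit.ValiantsHypothesis.ValiantsHypothesis.Theorems.BarrierLever.HiddenStates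

open Finset

noncomputable section

namespace PathTable

variable {ι₁ ι₂ : Type} [Fintype ι₁] [DecidableEq ι₁] [Fintype ι₂] [DecidableEq ι₂]

/-- the lift of a map on `ι₁` to `ι₁ ⊕ ι₂` (identity on `ι₂`). -/
theorem lift_mem_maps {T : Finset ι₁} {S : Finset (ι₁ ⊕ ι₂)} (hT : T = S.toLeft) {φ₁ : ι₁ → ι₁}
    (hφ₁ : φ₁ ∈ Fintype.piFinset (fun a => if a ∈ T then (Finset.univ : Finset ι₁) else {a})) :
    Sum.map φ₁ id ∈ Fintype.piFinset (fun a => if a ∈ S then (Finset.univ : Finset (ι₁ ⊕ ι₂)) else {a}) := by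
  rw [Fintype.mem_piFinset] at hφ₁ ⊢
  intro a
  rcases a with a₁ | z
  · by_cases ha : Sum.inl a₁ ∈ S
    · simp [ha]
    · have : a₁ ∉ T := by rw [hT, Finset.mem_toLeft]; exact ha
      have h1 := hφ₁ a₁
      rw [if_neg this, Finset.mem_singleton] at h1
      rw [if_neg ha, Finset.mem_singleton, Sum.map_inl, h1]
  · by_cases hz : Sum.inr z ∈ S
    · simp [hz]
    · rw [if_neg hz, Finset.mem_singleton]; rfl

/-- ★ **Inert factorisation of the row functional.**  With a table `w` on `ι₁ ⊕ ι₂` that is `w₁` on `ι₁`, has no `ι₂`-sources for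
`ι₁`-coordinates and is the identity on `ι₂`, and the functional `ζ' R = [R.toRight = Z]·ζ₁ R.toLeft`:
`Σ_{φ ∈ maps S} wt(φ) ζ'(S.image φ) = [S.toRight = Z] · Σ_{φ₁ ∈ maps S.toLeft} wt₁(φ₁) ζ₁(S.toLeft.image φ₁)`. -/
theorem sum_maps_inert (w₁ : ι₁ → ι₁ → ℂ) (ζ₁ : Finset ι₁ → ℂ) (Z : Finset ι₂)
    (w : ι₁ ⊕ ι₂ → ι₁ ⊕ ι₂ → ℂ) (hw11 : ∀ a q, w (Sum.inl a) (Sum.inl q) = w₁ a q)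
    (hw12 : ∀ a z, w (Sum.inl a) (Sum.inr z) = 0) (hw2 : ∀ z q, w (Sum.inr z) q = if q = Sum.inr z then 1 else 0)
    (ζ' : Finset (ι₁ ⊕ ι₂) → ℂ) (hζ' : ∀ R, ζ' R = if R.toRight = Z then ζ₁ R.toLeft else 0) (S : Finset (ι₁ ⊕ ι₂)) :
    ∑ φ ∈ Fintype.piFinset (fun a => if a ∈ S then (Finset.univ : Finset (ι₁ ⊕ ι₂)) else {a}),
        (∏ a ∈ S, w a (φ a)) * ζ' (S.image φ) =
      if S.toRight = Z then
        ∑ φ₁ ∈ Fintype.piFinset (fun a => if a ∈ S.toLeft then (Finset.univ : Finset ι₁) else {a}),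
          (∏ a ∈ S.toLeft, w₁ a (φ₁ a)) * ζ₁ (S.toLeft.image φ₁)
      else 0 := by
  classical
  set M₁ := Fintype.piFinset (fun a => if a ∈ S.toLeft then (Finset.univ : Finset ι₁) else {a}) with hM₁
  set M := Fintype.piFinset (fun a => if a ∈ S then (Finset.univ : Finset (ι₁ ⊕ ι₂)) else {a}) with hM
  -- the weight and the image of a lift
  have hwt : ∀ φ₁ : ι₁ → ι₁, ∏ a ∈ S, w a (Sum.map φ₁ id a) = ∏ a ∈ S.toLeft, w₁ a (φ₁ a) := by
    intro φ₁
    conv_lhs => rw [← Finset.toLeft_disjSum_toRight (u := S), Finset.prod_disjSum]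
    have h2 : ∏ z ∈ S.toRight, w (Sum.inr z) (Sum.map φ₁ id (Sum.inr z)) = 1 :=
      Finset.prod_eq_one fun z _ => by rw [hw2, Sum.map_inr, id_eq, if_pos rfl]
    rw [h2, mul_one]
    exact Finset.prod_congr rfl fun a _ => by rw [Sum.map_inl, hw11]
  have himg : ∀ φ₁ : ι₁ → ι₁, S.image (Sum.map φ₁ id) = (S.toLeft.image φ₁).disjSum S.toRight := by
    intro φ₁
    ext x
    rcases x with q | z
    · simp only [Finset.mem_image, Finset.inl_mem_disjSum]
      constructor
      · rintro ⟨y, hy, hyq⟩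
        rcases y with a | z'
        · exact ⟨a, Finset.mem_toLeft.2 hy, Sum.inl_injective hyq⟩
        · simp at hyq
      · rintro ⟨a, ha, rfl⟩
        exact ⟨Sum.inl a, Finset.mem_toLeft.1 ha, rfl⟩
    · simp only [Finset.mem_image, Finset.inr_mem_disjSum, Finset.mem_toRight]
      constructor
      · rintro ⟨y, hy, hyz⟩
        rcases y with a | z'
        · simp at hyz
        · simp only [Sum.map_inr, id_eq, Sum.inr.injEq] at hyz
          rwa [← hyz]
      · intro hz; exact ⟨Sum.inr z, hz, rfl⟩
  -- terms outside the lifts vanish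
  have hvan : ∀ φ ∈ M, φ ∉ M₁.image (fun φ₁ => Sum.map φ₁ id) → (∏ a ∈ S, w a (φ a)) * ζ' (S.image φ) = 0 := by
    intro φ hφ hnot
    by_contra hne
    have hwt0 : ∏ a ∈ S, w a (φ a) ≠ 0 := fun h => hne (by rw [h, zero_mul])
    apply hnot
    -- the candidate preimage
    let φ₁ : ι₁ → ι₁ := fun a => Sum.elim id (fun _ => a) (φ (Sum.inl a))
    have hφS : ∀ a, Sum.inl a ∈ S → ∃ q, φ (Sum.inl a) = Sum.inl q := by
      intro a ha
      have hwa : w (Sum.inl a) (φ (Sum.inl a)) ≠ 0 := fun h => hwt0 (Finset.prod_eq_zero ha h)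
      rcases hq : φ (Sum.inl a) with q | z
      · exact ⟨q, rfl⟩
      · rw [hq, hw12] at hwa; exact (hwa rfl).elim
    have hφout : ∀ x, x ∉ S → φ x = x := by
      intro x hx
      have := Fintype.mem_piFinset.1 hφ x
      rw [if_neg hx, Finset.mem_singleton] at this
      exact this
    have hlift : Sum.map φ₁ id = φ := by
      funext x
      rcases x with a | z
      · rw [Sum.map_inl]
        by_cases ha : Sum.inl a ∈ S
        · obtain ⟨q, hq⟩ := hφS a ha
          simp only [φ₁, hq, Sum.elim_inl, id_eq]
        · rw [hφout _ ha]; simp only [φ₁, hφout _ ha, Sum.elim_inl, id_eq]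
      · rw [Sum.map_inr, id_eq]
        by_cases hz : Sum.inr z ∈ S
        · have hwz : w (Sum.inr z) (φ (Sum.inr z)) ≠ 0 := fun h => hwt0 (Finset.prod_eq_zero hz h)
          rw [hw2] at hwz
          by_contra h
          exact hwz (if_neg (Ne.symm h))
        · exact (hφout _ hz).symm
    refine Finset.mem_image.2 ⟨φ₁, ?_, hlift⟩
    rw [hM₁, Fintype.mem_piFinset]
    intro a
    by_cases ha : a ∈ S.toLeft
    · simp [ha]
    · rw [if_neg ha, Finset.mem_singleton]
      have ha' : Sum.inl a ∉ S := fun h => ha (Finset.mem_toLeft.2 h)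
      simp only [φ₁, hφout _ ha', Sum.elim_inl, id_eq]
  -- restrict the sum to the lifts and pull back
  have hsub : M₁.image (fun φ₁ => Sum.map φ₁ id) ⊆ M := by
    intro φ hφ
    obtain ⟨φ₁, hφ₁, rfl⟩ := Finset.mem_image.1 hφ
    exact lift_mem_maps rfl hφ₁
  rw [← Finset.sum_subset hsub (fun φ hφ hnot => hvan φ hφ hnot),
    Finset.sum_image (fun φ₁ _ φ₁' _ h => by
      funext a; have := congrFun h (Sum.inl a); simpa using this)]
  split_ifs with hZ
  · refine Finset.sum_congr rfl fun φ₁ _ => ?_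
    rw [hwt, himg, hζ']
    have h1 : ((S.toLeft.image φ₁).disjSum S.toRight).toRight = S.toRight := by ext; simp
    have h2 : ((S.toLeft.image φ₁).disjSum S.toRight).toLeft = S.toLeft.image φ₁ := by ext; simp
    rw [h1, h2, if_pos hZ]
  · refine Finset.sum_eq_zero fun φ₁ _ => ?_
    rw [himg, hζ']
    have h1 : ((S.toLeft.image φ₁).disjSum S.toRight).toRight = S.toRight := by ext; simp
    rw [h1, if_neg hZ, mul_zero]

/-- ★ **The dual-vector criterion with inert coordinates.**  Data on `ι₁` as in `det_ne_zero_of_dual`; on `ι₁ ⊕ ι₂` the table `w`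
is `w₁` on `ι₁`, identity on `ι₂`, no cross sources; rows: injective, each either `Y₁ ⊔ Z` or of size `≤ k + |Z|` and `≠ X₁ ⊔ Z`;
columns: all points of size `≤ k + |Z|` occur.  Then the determinant is nonzero. -/
theorem det_ne_zero_of_dual_inert (w₁ : ι₁ → ι₁ → ℂ) (pot₁ : ι₁ → ℕ)
    (hw₁ : ∀ a q, w₁ a q ≠ 0 → q = a ∨ pot₁ q < pot₁ a) (hdiag₁ : ∀ a, w₁ a a = 1)
    (k : ℕ) (X₁ Y₁ : Finset ι₁) (ζ₁ : Finset ι₁ → ℂ) (hζ₁ : ∀ R, k < R.card → ζ₁ R = 0)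
    (hA₁ : ∀ S, S.card ≤ k → S ≠ X₁ →
      ∑ φ ∈ Fintype.piFinset (fun a => if a ∈ S then (Finset.univ : Finset ι₁) else {a}),
        (∏ a ∈ S, w₁ a (φ a)) * ζ₁ (S.image φ) = 0)
    (hB₁ : ∑ φ ∈ Fintype.piFinset (fun a => if a ∈ Y₁ then (Finset.univ : Finset ι₁) else {a}),
        (∏ a ∈ Y₁, w₁ a (φ a)) * ζ₁ (Y₁.image φ) ≠ 0)
    (Z : Finset ι₂) (w : ι₁ ⊕ ι₂ → ι₁ ⊕ ι₂ → ℂ) (hw11 : ∀ a q, w (Sum.inl a) (Sum.inl q) = w₁ a q)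
    (hw12 : ∀ a z, w (Sum.inl a) (Sum.inr z) = 0) (hw2 : ∀ z q, w (Sum.inr z) q = if q = Sum.inr z then 1 else 0)
    {r : ℕ} (rowS colJ : Fin r → Finset (ι₁ ⊕ ι₂)) (hinj : Function.Injective rowS)
    (hrow : ∀ i, ((rowS i).card ≤ k + Z.card ∧ rowS i ≠ X₁.disjSum Z) ∨ rowS i = Y₁.disjSum Z)
    (hcol : ∀ J : Finset (ι₁ ⊕ ι₂), J.card ≤ k + Z.card → ∃ kk, colJ kk = J) :
    (Matrix.of fun i kk : Fin r => ∏ a ∈ rowS i, ∑ q ∈ colJ kk, w a q).det ≠ 0 := by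
  classical
  -- the extended functional and potential
  let ζ' : Finset (ι₁ ⊕ ι₂) → ℂ := fun R => if R.toRight = Z then ζ₁ R.toLeft else 0
  let pot : ι₁ ⊕ ι₂ → ℕ := Sum.elim pot₁ (fun _ => 0)
  have hw : ∀ a q, w a q ≠ 0 → q = a ∨ pot q < pot a := by
    intro a q h
    rcases a with a₁ | z
    · rcases q with q₁ | z'
      · rw [hw11] at h
        rcases hw₁ a₁ q₁ h with h1 | h1
        · exact Or.inl (by rw [h1])
        · exact Or.inr h1
      · rw [hw12] at h; exact (h rfl).elim
    · rw [hw2] at h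
      by_cases hq : q = Sum.inr z
      · exact Or.inl hq
      · exact (h (if_neg hq)).elim
  have hdiag : ∀ a, w a a = 1 := by
    intro a
    rcases a with a₁ | z
    · rw [hw11, hdiag₁]
    · rw [hw2, if_pos rfl]
  have hfact := sum_maps_inert w₁ ζ₁ Z w hw11 hw12 hw2 ζ' (fun R => rfl)
  refine det_ne_zero_of_dual w pot hw hdiag (k + Z.card) (X₁.disjSum Z) (Y₁.disjSum Z) ζ' ?_ ?_ ?_ rowS colJ hinj hrow hcol
  · -- support
    intro R hR
    simp only [ζ']
    split_ifs with hZ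
    · apply hζ₁
      have := Finset.card_toLeft_add_card_toRight (u := R)
      rw [hZ] at this
      omega
    · rfl
  · -- annihilation
    intro S hS hX
    rw [hfact S]
    split_ifs with hZ
    · apply hA₁
      · have := Finset.card_toLeft_add_card_toRight (u := S)
        rw [hZ] at this; omega
      · intro hT
        apply hX
        rw [← Finset.toLeft_disjSum_toRight (u := S), hT, hZ]
    · rfl
  · -- the row `Y₁ ⊔ Z`
    rw [hfact]
    have h1 : (Y₁.disjSum Z).toRight = Z := by ext; simp
    have h2 : (Y₁.disjSum Z).toLeft = Y₁ := by ext; simp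
    rw [if_pos h1, h2]
    exact hB₁

end PathTable

end

end Summit.ValiantsHypothesis.ValiantsHypothesis.Theorems.BarrierLever.HiddenStates
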